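import Mathlib.AlgebraicGeometry.EllipticCurve.LFunction
import Mathlib.NumberTheory.LSeries.Injectivity
import Mathlib.Algebra.Field.GeomSum
import Literature.NumberTheory.EllipticCurves.AnalyticRank
import Literature.NumberTheory.LFunctions.DedekindZeta
import HarnessLib

/-!
# Discharge of `WeierstrassCurve.entireLFunction_not_eventuallyEq_zero` (Silverman AEC C.16)

D-0014 keeps `Literature/` sorry-free by stating cited results as named facts `def X : Prop`.
This sibling file of `Literature.NumberTheory.EllipticCurves.AnalyticRank` proves

* `WeierstrassCurve.entireLFunction_not_eventuallyEq_zero_holds`: for a Weierstrass curve `W`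
  over a number field admitting an entire continuation of `L(W,s)`, the continuation
  `W.entireLFunction` is not identically zero near `s = 1`.

## The mathematics (Silverman AEC 2nd ed., App. C §16, p. 450)

Silverman: "The product defining `L_{E/K}(s)` converges and gives an analytic function for all
`Re(s) > 3/2`" (from Hasse's bound `|a_v| ≤ 2√q_v`, V.2.4), i.e. `L(E,s) = ∑ aₙ n^{-s}` is an
honest Dirichlet series with `a₁ = 1` on a right half-plane. The vendored fact is the folklore
consequence: an entire function agreeing with `L(E,s)` there cannot vanish on a neighbourhood of
`1`, since then it vanishes on `ℂ` (identity theorem), whereas `L(E,σ) → a₁ = 1` as `σ → +∞`.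

**The one subtle point.** Mathlib's `LSeries f s` is a `tsum`, hence *is* identically `0` if the
series converges nowhere; so the proof must show that Mathlib's formal Dirichlet series
`WeierstrassCurve.LFunction W` (T. Browning, 2026: an Euler product `∏_𝔭 f_𝔭` over
`𝔭 : HeightOneSpectrum (𝓞 K)`, `f_𝔭 = 1/L_𝔭(q_𝔭^{-s})` with `q_𝔭 = Nat.card` of the residue field
of the completed integers `𝒪_𝔭` and `L_𝔭` built from `Nat.card` of the points of the reduced
minimal model) has polynomially bounded coefficients. Hasse is not needed (and the residue field
of `𝒪_𝔭` is not yet identified with `𝓞 K ⧸ 𝔭` in Mathlib); the *trivial* bounds suffice: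

1. `‖f_𝔭(m)‖ ≤ m³` (`WeierstrassCurve.norm_localEulerFactor_apply_le`): the reduced curve has at
   most `q² + 1` points (`WeierstrassCurve.natCard_point_le`), so the local polynomial
   `1 - aT + qT²`, `1 ∓ T` or `1` has coefficients of size `≤ q² + q + 1`, and the coefficients
   `b_k` of the inverse power series satisfy `|b_k| ≤ (q² + q + 2)^k ≤ q^{3k}`
   (`PowerSeries.norm_coeff_invOfUnit_one_le`). If the residue field is infinite/trivial
   (`Nat.card ≤ 1`, junk) the factor is `1`.
2. `N(𝔭) ≤ q_𝔭` (`IsDedekindDomain.HeightOneSpectrum.absNorm_le_natCard_residueField`: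
   `𝓞 K ⧸ 𝔭 ↪ 𝒪_𝔭 ⧸ 𝔪_𝔭`), and `∑_𝔭 N(𝔭)^{-2} < ∞`
   (`NumberField.summable_one_div_absNorm_sq_heightOneSpectrum`, from the convergence of the
   Dedekind zeta function for `Re s > 1`, `Literature.NumberTheory.LFunctions.LSeriesSummable_dedekindZeta` of
   `Literature.NumberTheory.LFunctions.DedekindZeta`).
3. A general majorant argument for Euler products of arithmetic functions
   (`ArithmeticFunction.norm_eulerProduct_apply_le_exp_mul_pow`): if `‖f_i(1)‖ ≤ 1`,
   `∑_{2 ≤ m ≤ N} ‖f_i(m)‖ m^{-t} ≤ ε_i` and `∑_{i ∈ s} ε_i ≤ E` for all finite `s`, then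
   `‖(∏ f_i)(n)‖ ≤ e^E n^t`; the key step is the sub-multiplicativity of truncated Dirichlet sums
   of nonnegative arithmetic functions (`ArithmeticFunction.sum_Icc_mul_apply_div_pow_le`).

Hence `|aₙ| ≤ C n⁵` (`WeierstrassCurve.exists_norm_LFunction_le`), `a₁ = 1`
(`WeierstrassCurve.LFunction_apply_one`), the L-series converges absolutely for `Re s > 6`
(`WeierstrassCurve.LSeriesSummable_LFunction_of_lt_re`) and `L(W,σ) → 1`
(`WeierstrassCurve.tendsto_LSeries_atTop`, via Mathlib's `LSeries.tendsto_atTop`).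

## Design

* General lemmas are deliberate dot-notation extensions of Mathlib's namespaces
  `ArithmeticFunction`, `PowerSeries`, `IsDedekindDomain.HeightOneSpectrum`, `NumberField`,
  `WeierstrassCurve` (written for upstreaming next to
  `Mathlib.NumberTheory.ArithmeticFunction.LFunction` and
  `Mathlib.AlgebraicGeometry.EllipticCurve.LFunction`).
* Norms `‖·‖` on a `NormedCommRing R` with `[NormOneClass R]` are used instead of `|·|` on `ℤ`
  where this costs nothing.
* The file introduces no definitions: truncated Dirichlet sums are written out as
  `∑ n ∈ Icc 1 N, F n / n ^ t`, norm majorants are hypotheses `‖f i n‖ ≤ F i n`, and the local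
  factors of `W.LFunction` appear as in Mathlib's definition (`LFunction_eq_eulerProduct`).

## References

* J. H. Silverman, *The Arithmetic of Elliptic Curves*, 2nd ed., GTM 106, Springer 2009,
  App. C §16 (p. 450) and Thm. V.2.4.
-/

noncomputable section

open Finset

/-! ### Majorants and truncated Dirichlet sums of arithmetic functions -/

namespace ArithmeticFunction

section Majorant

variable {R : Type*} [NormedCommRing R]

/-- Pointwise norm bounds are stable under Dirichlet convolution:
`‖(f * g)(n)‖ ≤ (F * G)(n)` if `‖f‖ ≤ F`, `‖g‖ ≤ G`. [folklore] -/
theorem norm_mul_apply_le {f g : ArithmeticFunction R} {F G : ArithmeticFunction ℝ}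
    (hf : ∀ n, ‖f n‖ ≤ F n) (hg : ∀ n, ‖g n‖ ≤ G n) (n : ℕ) :
    ‖(f * g) n‖ ≤ (F * G) n := by
  rw [mul_apply, mul_apply]
  refine (norm_sum_le _ _).trans (Finset.sum_le_sum fun x _ ↦ (norm_mul_le _ _).trans ?_)
  exact mul_le_mul (hf _) (hg _) (norm_nonneg _) ((norm_nonneg _).trans (hf _))

variable [NormOneClass R]

/-- Pointwise norm bounds are stable under finite Dirichlet products:
`‖(∏ᵢ fᵢ)(n)‖ ≤ (∏ᵢ Fᵢ)(n)` if `‖fᵢ‖ ≤ Fᵢ` for all `i`. [folklore] -/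
theorem norm_prod_apply_le {ι : Type*} (s : Finset ι) {f : ι → ArithmeticFunction R}
    {F : ι → ArithmeticFunction ℝ} (hF : ∀ i n, ‖f i n‖ ≤ F i n) (n : ℕ) :
    ‖(∏ i ∈ s, f i) n‖ ≤ (∏ i ∈ s, F i) n := by
  classical
  induction s using Finset.induction_on generalizing n with
  | empty => rcases eq_or_ne n 1 with rfl | hn <;> simp [*]
  | insert i s hi ih =>
    rw [prod_insert hi, prod_insert hi]
    exact norm_mul_apply_le (hF i) ih n

end Majorant

/-- Nonnegativity is stable under Dirichlet convolution. [folklore] -/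
theorem prod_apply_nonneg {ι : Type*} (s : Finset ι) {F : ι → ArithmeticFunction ℝ}
    (hF : ∀ i n, 0 ≤ F i n) (n : ℕ) : 0 ≤ (∏ i ∈ s, F i) n := by
  classical
  induction s using Finset.induction_on generalizing n with
  | empty => rcases eq_or_ne n 1 with rfl | hn <;> simp [*]
  | insert i s hi ih =>
    rw [prod_insert hi, mul_apply]
    exact sum_nonneg fun x _ ↦ mul_nonneg (hF _ _) (ih _)

/-- Truncated Dirichlet sums `∑_{1 ≤ n ≤ N} F(n) n^{-t}` (natural exponent `t`) of nonnegative
arithmetic functions are nonnegative. [folklore] -/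
theorem sum_Icc_div_pow_nonneg {F : ArithmeticFunction ℝ} (hF : ∀ n, 0 ≤ F n) (t N : ℕ) :
    0 ≤ ∑ n ∈ Icc 1 N, F n / (n : ℝ) ^ t :=
  sum_nonneg fun n _ ↦ div_nonneg (hF n) (by positivity)

/-- A single term `F(n) n^{-t}`, `1 ≤ n ≤ N`, is at most the truncated Dirichlet sum
`∑_{1 ≤ m ≤ N} F(m) m^{-t}` (`F ≥ 0`). [folklore] -/
theorem div_pow_le_sum_Icc_div_pow {F : ArithmeticFunction ℝ} (hF : ∀ n, 0 ≤ F n) (t : ℕ)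
    {n N : ℕ} (hn : n ≠ 0) (hnN : n ≤ N) :
    F n / (n : ℝ) ^ t ≤ ∑ m ∈ Icc 1 N, F m / (m : ℝ) ^ t :=
  single_le_sum (f := fun n ↦ F n / (n : ℝ) ^ t) (fun m _ ↦ div_nonneg (hF m) (by positivity))
    (mem_Icc.mpr ⟨Nat.one_le_iff_ne_zero.mpr hn, hnN⟩)

/-- **Sub-multiplicativity of truncated Dirichlet sums** of nonnegative arithmetic functions:
`∑_{n ≤ N} (F * G)(n) n^{-t} ≤ (∑_{n ≤ N} F(n) n^{-t}) (∑_{n ≤ N} G(n) n^{-t})`: the left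
side is the sum of `F(a)a^{-t} G(b)b^{-t}` over `ab ≤ N`, the right side over `a, b ≤ N`.
[folklore] -/
theorem sum_Icc_mul_apply_div_pow_le {F G : ArithmeticFunction ℝ} (hF : ∀ n, 0 ≤ F n)
    (hG : ∀ n, 0 ≤ G n) (t N : ℕ) :
    ∑ n ∈ Icc 1 N, (F * G) n / (n : ℝ) ^ t ≤
      (∑ n ∈ Icc 1 N, F n / (n : ℝ) ^ t) * ∑ n ∈ Icc 1 N, G n / (n : ℝ) ^ t := by
  have h1 : ∑ n ∈ Icc 1 N, (F * G) n / (n : ℝ) ^ t =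
      ∑ x ∈ (Icc 1 N).sigma fun n ↦ n.divisorsAntidiagonal,
        F x.2.1 / (x.2.1 : ℝ) ^ t * (G x.2.2 / (x.2.2 : ℝ) ^ t) := by
    rw [sum_sigma]
    refine sum_congr rfl fun n hn ↦ ?_
    rw [mul_apply, Finset.sum_div]
    refine sum_congr rfl fun x hx ↦ ?_
    obtain ⟨hxn, -⟩ := Nat.mem_divisorsAntidiagonal.mp hx
    rw [← hxn, Nat.cast_mul, mul_pow]
    ring
  have h2 : (∑ n ∈ Icc 1 N, F n / (n : ℝ) ^ t) * ∑ n ∈ Icc 1 N, G n / (n : ℝ) ^ t =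
      ∑ x ∈ Icc 1 N ×ˢ Icc 1 N, F x.1 / (x.1 : ℝ) ^ t * (G x.2 / (x.2 : ℝ) ^ t) := by
    rw [sum_product, sum_mul_sum]
  rw [h1, h2]
  have h3 : ∑ x ∈ (Icc 1 N).sigma (fun n ↦ n.divisorsAntidiagonal),
        F x.2.1 / (x.2.1 : ℝ) ^ t * (G x.2.2 / (x.2.2 : ℝ) ^ t) =
      ∑ x ∈ (Icc 1 N ×ˢ Icc 1 N).filter (fun x ↦ x.1 * x.2 ≤ N),
        F x.1 / (x.1 : ℝ) ^ t * (G x.2 / (x.2 : ℝ) ^ t) := by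
    refine sum_nbij' (fun x ↦ x.2) (fun x ↦ ⟨x.1 * x.2, x⟩) ?_ ?_ ?_ ?_ ?_
    · rintro ⟨n, ⟨a, b⟩⟩ hx
      simp only [mem_sigma, mem_Icc, Nat.mem_divisorsAntidiagonal] at hx
      obtain ⟨⟨h1n, hnN⟩, hab, hn0⟩ := hx
      subst hab
      have ha : 0 < a := Nat.pos_of_ne_zero (left_ne_zero_of_mul hn0)
      have hb : 0 < b := Nat.pos_of_ne_zero (right_ne_zero_of_mul hn0)
      simp only [mem_filter, mem_product, mem_Icc]
      refine ⟨⟨⟨ha, ?_⟩, hb, ?_⟩, hnN⟩ <;> nlinarith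
    · rintro ⟨a, b⟩ hx
      simp only [mem_filter, mem_product, mem_Icc] at hx
      obtain ⟨⟨⟨ha1, -⟩, hb1, -⟩, habN⟩ := hx
      have hab : a * b ≠ 0 := Nat.mul_ne_zero (by omega) (by omega)
      exact mem_sigma.mpr ⟨mem_Icc.mpr ⟨Nat.one_le_iff_ne_zero.mpr hab, habN⟩,
        Nat.mem_divisorsAntidiagonal.mpr ⟨rfl, hab⟩⟩
    · rintro ⟨n, ⟨a, b⟩⟩ hx
      simp only [mem_sigma, Nat.mem_divisorsAntidiagonal] at hx
      obtain ⟨-, hab, -⟩ := hx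
      subst hab
      rfl
    · rintro ⟨a, b⟩ _
      rfl
    · intro x _
      rfl
  rw [h3]
  refine sum_le_sum_of_subset_of_nonneg (filter_subset _ _) fun x _ _ ↦ ?_
  exact mul_nonneg (div_nonneg (hF _) (by positivity)) (div_nonneg (hG _) (by positivity))

/-- Sub-multiplicativity of truncated Dirichlet sums for finite Dirichlet products of nonnegative
arithmetic functions. [folklore] -/
theorem sum_Icc_prod_apply_div_pow_le {ι : Type*} (s : Finset ι) {F : ι → ArithmeticFunction ℝ}
    (hF : ∀ i n, 0 ≤ F i n) (t N : ℕ) :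
    ∑ n ∈ Icc 1 N, (∏ i ∈ s, F i) n / (n : ℝ) ^ t ≤
      ∏ i ∈ s, ∑ n ∈ Icc 1 N, F i n / (n : ℝ) ^ t := by
  classical
  induction s using Finset.induction_on with
  | empty =>
    simp only [prod_empty]
    rcases Nat.eq_zero_or_pos N with rfl | hN
    · simp
    · rw [sum_eq_single_of_mem 1 (mem_Icc.mpr ⟨le_rfl, hN⟩)]
      · simp
      · intro n hn hn1
        simp [hn1]
  | insert i s hi ih =>
    rw [prod_insert hi, prod_insert hi]
    refine (sum_Icc_mul_apply_div_pow_le (hF i) (prod_apply_nonneg s hF) t N).trans ?_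
    exact mul_le_mul_of_nonneg_left ih (sum_Icc_div_pow_nonneg (hF i) t N)

/-- **Uniform polynomial bound for finite Euler products.** If each `f i` has `‖f i 1‖ ≤ 1`, the
tails `∑_{2 ≤ m ≤ N} ‖f i m‖ m^{-t}` are bounded by `ε i` uniformly in `N`, and the finite sums
`∑_{i ∈ s} ε i` are bounded by `E`, then every finite product `∏_{i ∈ s} f i` has `n`-th
coefficient of norm at most `exp E · n ^ t` (majorise by the Dirichlet product of the norm
majorants `F i = ‖f i‖`, then by `∏ (1 + ε i) ≤ exp (∑ ε i)`). [folklore] -/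
theorem norm_finsetProd_apply_le_exp_mul_pow {ι : Type*} {R : Type*} [NormedCommRing R]
    [NormOneClass R] {f : ι → ArithmeticFunction R}
    {ε : ι → ℝ} {E : ℝ} {t : ℕ} (h1 : ∀ i, ‖f i 1‖ ≤ 1)
    (hε : ∀ i N, ∑ m ∈ Icc 2 N, ‖f i m‖ / (m : ℝ) ^ t ≤ ε i)
    (hE : ∀ s : Finset ι, ∑ i ∈ s, ε i ≤ E) (s : Finset ι) {n : ℕ} (hn : n ≠ 0) :
    ‖(∏ i ∈ s, f i) n‖ ≤ Real.exp E * (n : ℝ) ^ t := by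
  -- the norm majorants `F i = (m ↦ ‖f i m‖)` as real arithmetic functions
  obtain ⟨F, hF⟩ : ∃ F : ι → ArithmeticFunction ℝ, ∀ i m, F i m = ‖f i m‖ :=
    ⟨fun i ↦ ⟨fun m ↦ ‖f i m‖, by simp⟩, fun _ _ ↦ rfl⟩
  have hF0 : ∀ i m, 0 ≤ F i m := fun i m ↦ (hF i m).symm ▸ norm_nonneg (f i m)
  have hnpos : (0 : ℝ) < (n : ℝ) ^ t := by positivity
  -- Step 1: majorise by the product of norm majorants
  refine (norm_prod_apply_le s (fun i m ↦ (hF i m).ge) n).trans ?_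
  -- Step 2: a single coefficient is bounded by the truncated Dirichlet sum
  have step2 : (∏ i ∈ s, F i) n / (n : ℝ) ^ t ≤
      ∑ m ∈ Icc 1 n, (∏ i ∈ s, F i) m / (m : ℝ) ^ t :=
    div_pow_le_sum_Icc_div_pow (prod_apply_nonneg s hF0) t hn le_rfl
  -- Step 3: sub-multiplicativity
  have step3 := sum_Icc_prod_apply_div_pow_le s hF0 t n
  -- Step 4: each factor is at most `1 + ε i ≤ exp (ε i)`
  have step4 : ∀ i, ∑ m ∈ Icc 1 n, F i m / (m : ℝ) ^ t ≤ Real.exp (ε i) := by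
    intro i
    refine le_trans ?_ (Real.add_one_le_exp (ε i))
    have hsplit : Icc 1 n = insert 1 (Icc 2 n) := by
      ext m
      simp only [mem_Icc, mem_insert]
      omega
    rw [hsplit, sum_insert (by simp), add_comm]
    simp only [hF]
    refine add_le_add (hε i n) ?_
    simpa using h1 i
  calc (∏ i ∈ s, F i) n
      = (∏ i ∈ s, F i) n / (n : ℝ) ^ t * (n : ℝ) ^ t := by
        rw [div_mul_cancel₀ _ hnpos.ne']
    _ ≤ (∏ i ∈ s, ∑ m ∈ Icc 1 n, F i m / (m : ℝ) ^ t) * (n : ℝ) ^ t := by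
        gcongr
        exact step2.trans step3
    _ ≤ (∏ i ∈ s, Real.exp (ε i)) * (n : ℝ) ^ t := by
        gcongr with i hi
        · exact fun i _ ↦ sum_Icc_div_pow_nonneg (hF0 i) t n
        · exact step4 i
    _ ≤ Real.exp E * (n : ℝ) ^ t := by
        gcongr
        rw [← Real.exp_sum]
        exact Real.exp_le_exp.mpr (hE s)

open Filter in
/-- **Polynomial coefficient bound for Euler products.** Mathlib's `ArithmeticFunction.eulerProduct`
is coefficientwise an eventually constant limit of finite products, so it inherits the uniform
bound of `norm_finsetProd_apply_le_exp_mul_pow`: `‖(∏' f i)(n)‖ ≤ exp E · n ^ t`. [folklore] -/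
theorem norm_eulerProduct_apply_le_exp_mul_pow {ι : Type*} {R : Type*} [NormedCommRing R]
    [NormOneClass R] {f : ι → ArithmeticFunction R}
    (hf : ∀ n, ∀ᶠ i in cofinite, f i n = (1 : ArithmeticFunction R) n)
    {ε : ι → ℝ} {E : ℝ} {t : ℕ} (h1 : ∀ i, ‖f i 1‖ ≤ 1)
    (hε : ∀ i N, ∑ m ∈ Icc 2 N, ‖f i m‖ / (m : ℝ) ^ t ≤ ε i)
    (hE : ∀ s : Finset ι, ∑ i ∈ s, ε i ≤ E) {n : ℕ} (hn : n ≠ 0) :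
    ‖eulerProduct f n‖ ≤ Real.exp E * (n : ℝ) ^ t := by
  obtain ⟨s, hs⟩ := (tendsTo_eulerProduct_of_tendsTo f hf n).exists
  rw [← hs]
  exact norm_finsetProd_apply_le_exp_mul_pow h1 hε hE s hn

/-- `(∏ᵢ fᵢ)(1) = ∏ᵢ fᵢ(1)`. [folklore] -/
theorem finsetProd_apply_one {ι : Type*} {S : Type*} [CommSemiring S] (s : Finset ι)
    (f : ι → ArithmeticFunction S) : (∏ i ∈ s, f i) 1 = ∏ i ∈ s, f i 1 := by
  classical
  induction s using Finset.induction_on with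
  | empty => simp
  | insert i s hi ih => rw [prod_insert hi, prod_insert hi, mul_apply_one, ih]

open Filter in
/-- The Euler product of arithmetic functions with `f i 1 = 1` has first coefficient `1`.
[folklore] -/
theorem eulerProduct_apply_one {ι : Type*} {S : Type*} [CommSemiring S]
    {f : ι → ArithmeticFunction S}
    (hf : ∀ n, ∀ᶠ i in cofinite, f i n = (1 : ArithmeticFunction S) n)
    (h1 : ∀ i, f i 1 = 1) : eulerProduct f 1 = 1 := by
  obtain ⟨s, hs⟩ := (tendsTo_eulerProduct_of_tendsTo f hf 1).exists
  rw [← hs, finsetProd_apply_one]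
  exact prod_eq_one fun i _ ↦ h1 i

end ArithmeticFunction

end

noncomputable section

open Finset

/-! ### Coefficients of the inverse of a power series with bounded coefficients -/

namespace PowerSeries

variable {R : Type*} [NormedCommRing R] [NormOneClass R]

/-- If `φ = 1 + c₁ X + c₂ X² + ⋯` has `‖cᵢ‖ ≤ M` for `i ≥ 1`, then the coefficients `bⱼ` of
`1/φ = PowerSeries.invOfUnit φ 1` satisfy `∑_{j ≤ n} ‖bⱼ‖ ≤ (M + 1) ^ n` (induction on the
recursion `bₙ = -∑_{i ≥ 1} cᵢ bₙ₋ᵢ`). [folklore] -/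
theorem sum_norm_coeff_invOfUnit_one_le (φ : R⟦X⟧) {M : ℝ} (hM : 0 ≤ M)
    (hφ : ∀ i, i ≠ 0 → ‖coeff i φ‖ ≤ M) (n : ℕ) :
    ∑ j ∈ range (n + 1), ‖coeff j (invOfUnit φ 1)‖ ≤ (M + 1) ^ n := by
  induction n with
  | zero =>
    simp only [zero_add, sum_range_one, pow_zero, coeff_zero_eq_constantCoeff,
      constantCoeff_invOfUnit, inv_one, Units.val_one, norm_one, le_refl]
  | succ n ih =>
    set b := invOfUnit φ 1 with hb
    have hS : 0 ≤ ∑ j ∈ range (n + 1), ‖coeff j b‖ := sum_nonneg fun _ _ ↦ norm_nonneg _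
    have key : ‖coeff (n + 1) b‖ ≤ M * ∑ j ∈ range (n + 1), ‖coeff j b‖ := by
      rw [hb, coeff_invOfUnit, if_neg n.succ_ne_zero]
      simp only [inv_one, Units.val_one, neg_mul, one_mul, norm_neg]
      refine (norm_sum_le _ _).trans ?_
      rw [Nat.sum_antidiagonal_succ]
      simp only [lt_self_iff_false, if_false, norm_zero, zero_add]
      calc ∑ p ∈ antidiagonal n, ‖if p.2 < n + 1 then coeff (p.1 + 1) φ * coeff p.2 (invOfUnit φ 1)
              else 0‖
          ≤ ∑ p ∈ antidiagonal n, M * ‖coeff p.2 (invOfUnit φ 1)‖ := by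
            refine sum_le_sum fun p hp ↦ ?_
            have hp2 : p.2 < n + 1 := by have := mem_antidiagonal.mp hp; omega
            rw [if_pos hp2]
            exact (norm_mul_le _ _).trans
              (mul_le_mul_of_nonneg_right (hφ _ (Nat.succ_ne_zero _)) (norm_nonneg _))
        _ = M * ∑ j ∈ range (n + 1), ‖coeff j (invOfUnit φ 1)‖ := by
            rw [mul_sum, ← Nat.sum_antidiagonal_swap, Nat.sum_antidiagonal_eq_sum_range_succ_mk]
            rfl
    rw [sum_range_succ, pow_succ]
    calc ∑ j ∈ range (n + 1), ‖coeff j b‖ + ‖coeff (n + 1) b‖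
        ≤ ∑ j ∈ range (n + 1), ‖coeff j b‖ + M * ∑ j ∈ range (n + 1), ‖coeff j b‖ := by gcongr
      _ = (∑ j ∈ range (n + 1), ‖coeff j b‖) * (M + 1) := by ring
      _ ≤ (M + 1) ^ n * (M + 1) := by gcongr

/-- If `φ = 1 + c₁ X + c₂ X² + ⋯` has `‖cᵢ‖ ≤ M` for `i ≥ 1`, then the `n`-th coefficient of
`1/φ = PowerSeries.invOfUnit φ 1` has norm at most `(M + 1) ^ n`. [folklore] -/
theorem norm_coeff_invOfUnit_one_le (φ : R⟦X⟧) {M : ℝ} (hM : 0 ≤ M)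
    (hφ : ∀ i, i ≠ 0 → ‖coeff i φ‖ ≤ M) (n : ℕ) :
    ‖coeff n (invOfUnit φ 1)‖ ≤ (M + 1) ^ n := by
  refine le_trans ?_ (sum_norm_coeff_invOfUnit_one_le φ hM hφ n)
  exact single_le_sum (f := fun j ↦ ‖coeff j (invOfUnit φ 1)‖) (fun _ _ ↦ norm_nonneg _)
    (self_mem_range_succ n)

end PowerSeries

/-! ### Dirichlet series supported on powers of `q` -/

namespace ArithmeticFunction

/-- If the coefficients of `F` satisfy `‖coeff k F‖ ≤ (q ^ 3) ^ k` and `q ≥ 2`, then the tails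
`∑_{2 ≤ m ≤ N} ‖f(m)‖ m^{-5}` of the Dirichlet series `f = F(q⁻ˢ)` are at most `2 / q ^ 2`
(geometric series `∑_{k ≥ 1} q^{-2k}`). [folklore] -/
theorem sum_Icc_norm_ofPowerSeries_div_pow_le {q : ℕ} (hq : 1 < q) (F : PowerSeries ℤ)
    (hF : ∀ k, ‖PowerSeries.coeff k F‖ ≤ ((q : ℝ) ^ 3) ^ k) (N : ℕ) :
    ∑ m ∈ Icc 2 N, ‖ofPowerSeries q F m‖ / (m : ℝ) ^ 5 ≤ 2 / (q : ℝ) ^ 2 := by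
  classical
  have hq0 : (0 : ℝ) < q := by exact_mod_cast (zero_lt_one.trans hq)
  have hq2 : (2 : ℝ) ≤ q := by exact_mod_cast hq
  set r : ℝ := ((q : ℝ) ^ 2)⁻¹ with hr
  have hr0 : 0 < r := by positivity
  have hr4 : r ≤ 1 / 4 := by
    rw [hr, inv_eq_one_div]
    gcongr
    nlinarith
  -- Step 1: restrict to the powers of `q`.
  have hsupp : ∀ m ∈ Icc 2 N, ‖ofPowerSeries q F m‖ / (m : ℝ) ^ 5 ≠ 0 → ∃ k, q ^ k = m := by
    intro m _ hm
    by_contra hkm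
    rw [ofPowerSeries_apply hq, Function.extend_apply' _ _ _ hkm] at hm
    simp at hm
  rw [← sum_filter_of_ne hsupp]
  -- Step 2: the powers of `q` in `[2, N]` are among `q ^ 1, …, q ^ N`.
  have hsub : (Icc 2 N).filter (fun m ↦ ∃ k, q ^ k = m) ⊆ (Ico 1 (N + 1)).image (q ^ ·) := by
    intro m hm
    simp only [mem_filter, mem_Icc] at hm
    obtain ⟨⟨h2m, hmN⟩, k, rfl⟩ := hm
    refine mem_image.mpr ⟨k, mem_Ico.mpr ⟨?_, ?_⟩, rfl⟩
    · by_contra hk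
      simp only [not_le, Nat.lt_one_iff] at hk
      subst hk
      simp at h2m
    · exact Nat.lt_succ_of_le ((Nat.lt_pow_self hq).le.trans hmN)
  refine (sum_le_sum_of_subset_of_nonneg hsub fun _ _ _ ↦ by positivity).trans ?_
  rw [sum_image fun a _ b _ hab ↦ Nat.pow_right_injective hq hab]
  -- Step 3: compare with a geometric series of ratio `r = q⁻²`.
  calc ∑ k ∈ Ico 1 (N + 1), ‖ofPowerSeries q F (q ^ k)‖ / ((q ^ k : ℕ) : ℝ) ^ 5
      ≤ ∑ k ∈ Ico 1 (N + 1), r ^ k := by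
        refine sum_le_sum fun k _ ↦ ?_
        rw [ofPowerSeries_apply_pow hq, div_le_iff₀ (by positivity)]
        refine (hF k).trans (le_of_eq ?_)
        rw [hr, inv_pow, inv_mul_eq_div, eq_div_iff (by positivity)]
        push_cast
        ring
    _ = (r ^ 1 - r ^ (N + 1)) / (1 - r) := geom_sum_Ico' (by linarith) (by omega)
    _ ≤ r / (1 - r) := by
        rw [pow_one]
        gcongr
        · linarith
        · linarith [pow_nonneg hr0.le (N + 1)]
    _ ≤ 2 * r := by
        rw [div_le_iff₀ (by linarith)]
        nlinarith
    _ = 2 / (q : ℝ) ^ 2 := by rw [hr, div_eq_mul_inv]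

end ArithmeticFunction

/-! ### Local Euler factors of Weierstrass curves -/

namespace WeierstrassCurve

/-- Over a finite ring `k`, a Weierstrass curve has at most `|k|² + 1` (affine plus infinity)
points: the nonsingular affine points inject into `k × k`. [folklore] -/
theorem natCard_point_le {k : Type*} [CommRing k] [Finite k] (V : WeierstrassCurve k) :
    Nat.card V.toAffine.Point ≤ Nat.card k * Nat.card k + 1 := by
  let e : V.toAffine.Point → Option (k × k) := fun P ↦ match P with
    | .zero => none
    | .some x y _ => some (x, y)
  have he : Function.Injective e := by
    rintro (_ | ⟨x, y, h⟩) (_ | ⟨x', y', h'⟩) hh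
    · rfl
    · simp [e] at hh
    · simp [e] at hh
    · simp only [e, Option.some.injEq, Prod.mk.injEq] at hh
      obtain ⟨rfl, rfl⟩ := hh
      rfl
  calc Nat.card _ ≤ Nat.card (Option (k × k)) := Nat.card_le_card_of_injective e he
    _ = _ := by rw [Finite.card_option, Nat.card_prod]

section LocalField

variable (R : Type*) [CommRing R] [IsDomain R] [IsDiscreteValuationRing R] {K : Type*}
  [Field K] [Algebra R K] [IsFractionRing R K] (W : WeierstrassCurve K)

/-- The local power series `1 / L_v(T)` has constant coefficient `1`. [folklore] -/
theorem constantCoeff_localPowerSeries : (W.localPowerSeries R).constantCoeff = 1 := by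
  rw [localPowerSeries, PowerSeries.constantCoeff_invOfUnit]
  simp

/-- The local Euler factor has first Dirichlet coefficient `1`. [folklore] -/
theorem localEulerFactor_apply_one : W.localEulerFactor R 1 = 1 := by
  rw [localEulerFactor, ArithmeticFunction.ofPowerSeries_apply_one, constantCoeff_localPowerSeries]

/-- The trivial bound on the coefficients of the local polynomial: with `q = |κ|` the (finite)
residue field, every non-constant coefficient has absolute value at most `q² + q + 1`
(from `|W̃(κ)| ≤ q² + 1`; Silverman AEC C.16 uses instead Hasse's `|a| ≤ 2√q`, V.2.4).
[folklore] -/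
theorem norm_coeff_localPolynomial_le [Finite (IsLocalRing.ResidueField R)] {i : ℕ} (hi : i ≠ 0) :
    ‖((W.localPolynomial R).coeff i : ℤ)‖ ≤
      (Nat.card (IsLocalRing.ResidueField R) : ℝ) ^ 2 +
        Nat.card (IsLocalRing.ResidueField R) + 1 := by
  set q : ℕ := Nat.card (IsLocalRing.ResidueField R) with hq
  have hq0 : (0 : ℝ) ≤ q := Nat.cast_nonneg _
  have hpts := natCard_point_le ((W.minimal R).reduction R)
  rw [← hq] at hpts
  unfold localPolynomial
  split_ifs
  · -- good reduction: `1 - a X + q X²`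
    simp only [Polynomial.coeff_add, Polynomial.coeff_sub, Polynomial.coeff_one,
      Polynomial.coeff_C_mul, Polynomial.coeff_X, Polynomial.coeff_X_pow, if_neg hi, zero_sub]
    rcases eq_or_ne i 1 with rfl | hi1
    · simp only [if_true, mul_one, show (1 : ℕ) ≠ 2 by decide, if_false, mul_zero, add_zero,
        norm_neg, ← hq]
      rw [Int.norm_eq_abs]
      push_cast
      rw [abs_le]
      constructor
      · have : ((Nat.card ((W.minimal R).reduction R).toAffine.Point : ℤ) : ℝ) ≤ q * q + 1 := by
          exact_mod_cast hpts
        push_cast at this ⊢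
        nlinarith
      · have : (0 : ℝ) ≤ ((Nat.card ((W.minimal R).reduction R).toAffine.Point : ℤ) : ℝ) := by
          positivity
        nlinarith
    · rw [if_neg (Ne.symm hi1), mul_zero, neg_zero, zero_add]
      rcases eq_or_ne i 2 with rfl | hi2
      · simp only [if_true, mul_one, ← hq]
        rw [Int.norm_eq_abs]
        push_cast
        rw [abs_of_nonneg hq0]
        nlinarith
      · simp only [hi2, if_false, mul_zero, norm_zero]
        positivity
  · -- split multiplicative: `1 - X`
    simp only [Polynomial.coeff_sub, Polynomial.coeff_one, Polynomial.coeff_X, if_neg hi, zero_sub,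
      norm_neg]
    split_ifs <;> simp <;> positivity
  · -- nonsplit multiplicative: `1 + X`
    simp only [Polynomial.coeff_add, Polynomial.coeff_one, Polynomial.coeff_X, if_neg hi, zero_add]
    split_ifs <;> simp <;> positivity
  · -- additive: `1`
    simp only [Polynomial.coeff_one, if_neg hi, norm_zero]
    positivity

/-- For `q = |κ| ≥ 2`, the coefficients of the local power series `1 / L_v(T) = ∑ bₖ T^k` satisfy
the trivial bound `|bₖ| ≤ q^{3k}`. [folklore] -/
theorem norm_coeff_localPowerSeries_le (hq : 1 < Nat.card (IsLocalRing.ResidueField R)) (k : ℕ) :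
    ‖(PowerSeries.coeff k (W.localPowerSeries R) : ℤ)‖ ≤
      ((Nat.card (IsLocalRing.ResidueField R) : ℝ) ^ 3) ^ k := by
  haveI : Finite (IsLocalRing.ResidueField R) :=
    Nat.finite_of_card_ne_zero (Nat.ne_zero_of_lt hq)
  set q : ℕ := Nat.card (IsLocalRing.ResidueField R) with hqdef
  have hq2 : (2 : ℝ) ≤ q := by exact_mod_cast hq
  have hM : (0 : ℝ) ≤ (q : ℝ) ^ 2 + q + 1 := by positivity
  refine (PowerSeries.norm_coeff_invOfUnit_one_le _ hM (fun i hi ↦ ?_) k).trans ?_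
  · rw [Polynomial.coeff_coe]
    exact W.norm_coeff_localPolynomial_le R hi
  · gcongr
    nlinarith

/-- The trivial bound `|f_v(m)| ≤ m³` on the coefficients of the local Euler factor
`f_v = 1 / L_v(q⁻ˢ)` of a Weierstrass curve (any residue field; `q ≤ 1` is the junk case
`f_v = 1`). [folklore] -/
theorem norm_localEulerFactor_apply_le (m : ℕ) : ‖(W.localEulerFactor R m : ℤ)‖ ≤ (m : ℝ) ^ 3 := by
  set q : ℕ := Nat.card (IsLocalRing.ResidueField R) with hqdef
  by_cases hq : 1 < q
  · rw [localEulerFactor, ← hqdef]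
    by_cases hm : ∃ k, q ^ k = m
    · obtain ⟨k, rfl⟩ := hm
      rw [ArithmeticFunction.ofPowerSeries_apply_pow hq]
      refine (W.norm_coeff_localPowerSeries_le R hq k).trans (le_of_eq ?_)
      push_cast
      ring
    · rw [ArithmeticFunction.ofPowerSeries_apply hq, Function.extend_apply' _ _ _ hm]
      simp only [Pi.zero_apply, norm_zero]
      positivity
  · have h1 : W.localEulerFactor R = 1 := by
      rw [localEulerFactor, ← hqdef, ArithmeticFunction.ofPowerSeries, AlgHom.coe_mk]
      simp [hq, constantCoeff_localPowerSeries]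
    rw [h1, ArithmeticFunction.one_apply]
    split_ifs with hm
    · subst hm; simp
    · simp only [norm_zero]; positivity

/-- If the residue field is infinite or trivial (`Nat.card ≤ 1`, a junk case), the local Euler
factor is `1`. [folklore] -/
theorem localEulerFactor_eq_one_of_card_le_one (hq : Nat.card (IsLocalRing.ResidueField R) ≤ 1) :
    W.localEulerFactor R = 1 := by
  rw [localEulerFactor, ArithmeticFunction.ofPowerSeries]
  simp [not_lt.mpr hq, constantCoeff_localPowerSeries]

/-- For `q = |κ| ≥ 2` the local Euler factor is supported on the powers of `q`. [folklore] -/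
theorem localEulerFactor_apply_eq_zero (hq : 1 < Nat.card (IsLocalRing.ResidueField R)) {m : ℕ}
    (hm : ¬ ∃ k, Nat.card (IsLocalRing.ResidueField R) ^ k = m) : W.localEulerFactor R m = 0 := by
  rw [localEulerFactor, ArithmeticFunction.ofPowerSeries_apply hq, Function.extend_apply' _ _ _ hm,
    Pi.zero_apply]

/-- Tail bound for the local Euler factor: `∑_{2 ≤ m ≤ N} |f_v(m)| m^{-5} ≤ 2 / q²` (`q ≥ 2`).
[folklore] -/
theorem sum_Icc_norm_localEulerFactor_div_pow_le
    (hq : 1 < Nat.card (IsLocalRing.ResidueField R)) (N : ℕ) :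
    ∑ m ∈ Icc 2 N, ‖(W.localEulerFactor R m : ℤ)‖ / (m : ℝ) ^ 5 ≤
      2 / (Nat.card (IsLocalRing.ResidueField R) : ℝ) ^ 2 :=
  ArithmeticFunction.sum_Icc_norm_ofPowerSeries_div_pow_le hq _
    (W.norm_coeff_localPowerSeries_le R hq) N

end LocalField

end WeierstrassCurve

end

noncomputable section

open Finset Filter

/-! ### Residue fields of completions and norms of primes -/

namespace IsDedekindDomain.HeightOneSpectrum

variable {R : Type*} [CommRing R] [IsDedekindDomain R] [Module.Free ℤ R] {K : Type*} [Field K]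
  [Algebra R K] [IsFractionRing R K] (v : HeightOneSpectrum R)

/-- The residue field `R ⧸ v` embeds into the residue field of the `v`-adic integers `𝒪_v`, so
`N(v) = |R ⧸ v| ≤ |𝒪_v ⧸ 𝔪_v|` whenever the latter is finite. (In fact equality holds, but the
inequality is all that is needed here.) [folklore] -/
theorem absNorm_le_natCard_residueField
    [Finite (IsLocalRing.ResidueField (v.adicCompletionIntegers K))] :
    Ideal.absNorm v.asIdeal ≤ Nat.card (IsLocalRing.ResidueField (v.adicCompletionIntegers K)) := by
  let f : R →+* IsLocalRing.ResidueField (v.adicCompletionIntegers K) :=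
    (IsLocalRing.residue _).comp (algebraMap R (v.adicCompletionIntegers K))
  have hker : ∀ r ∈ v.asIdeal, f r = 0 := by
    intro r hr
    simp only [f, RingHom.comp_apply, IsLocalRing.residue_eq_zero_iff, IsLocalRing.mem_maximalIdeal,
      mem_nonunits_iff, adicCompletionIntegers.isUnit_iff_valued_eq_one,
      algebraMap_adicCompletionIntegers_apply]
    rw [valuedAdicCompletion_eq_valuation']
    exact ((valuation_lt_one_iff_mem v r).mpr hr).ne
  letI := Ideal.Quotient.field v.asIdeal
  let g : R ⧸ v.asIdeal →+* IsLocalRing.ResidueField (v.adicCompletionIntegers K) :=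
    Ideal.Quotient.lift v.asIdeal f hker
  rw [Ideal.absNorm_apply, Submodule.cardQuot_apply]
  exact Nat.card_le_card_of_injective g g.injective

end IsDedekindDomain.HeightOneSpectrum

namespace NumberField

variable (K : Type*) [Field K] [NumberField K]

/-- `∑_I N(I)^{-2} < ∞` over all integral ideals of a number field (the term for `I = 0`, of
norm `0`, is the junk value `0`); from the convergence of the Dedekind zeta function at `s = 2`
(`Literature.NumberTheory.LFunctions.LSeriesSummable_dedekindZeta` of `Literature.NumberTheory.LFunctions.DedekindZeta`).
[folklore] -/
theorem summable_one_div_absNorm_sq :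
    Summable fun I : Ideal (𝓞 K) ↦ 1 / (Ideal.absNorm I : ℝ) ^ 2 := by
  -- summability of `n ↦ #{N(I) = n} / n²`
  have h2 : Summable fun n : ℕ ↦
      (Nat.card {I : Ideal (𝓞 K) // Ideal.absNorm I = n} : ℝ) / (n : ℝ) ^ 2 := by
    have := (Literature.NumberTheory.LFunctions.LSeriesSummable_dedekindZeta (K := K) (s := 2) (by norm_num)).norm
    refine this.congr fun n ↦ ?_
    rw [LSeries.norm_term_eq]
    rcases eq_or_ne n 0 with rfl | hn
    · simp
    · simp only [if_neg hn, Complex.norm_natCast]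
      norm_num
  -- regroup the sum over ideals along the fibres of `Ideal.absNorm`
  let e := Equiv.sigmaFiberEquiv (fun I : Ideal (𝓞 K) ↦ Ideal.absNorm I)
  rw [← e.summable_iff]
  have hF : (fun I : Ideal (𝓞 K) ↦ 1 / (Ideal.absNorm I : ℝ) ^ 2) ∘ e =
      fun x : Σ n : ℕ, {I : Ideal (𝓞 K) // Ideal.absNorm I = n} ↦ 1 / (x.1 : ℝ) ^ 2 := by
    funext ⟨n, I, hI⟩
    simp [e, hI]
  rw [hF, summable_sigma_of_nonneg (fun _ ↦ by positivity)]
  constructor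
  · intro n
    haveI : Finite {I : Ideal (𝓞 K) // Ideal.absNorm I = n} :=
      (Ideal.finite_setOf_absNorm_eq n).to_subtype
    exact Summable.of_finite
  · simp only [tsum_const, nsmul_eq_mul]
    simpa [div_eq_mul_inv] using h2

/-- `∑_𝔭 N(𝔭)^{-2} < ∞` over the nonzero primes of a number field. [folklore] -/
theorem summable_one_div_absNorm_sq_heightOneSpectrum :
    Summable fun v : IsDedekindDomain.HeightOneSpectrum (𝓞 K) ↦
      1 / (Ideal.absNorm v.asIdeal : ℝ) ^ 2 :=
  (summable_one_div_absNorm_sq K).comp_injective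
    (fun _ _ h ↦ IsDedekindDomain.HeightOneSpectrum.ext h)

/-- There are only finitely many primes of norm at most `n`. [folklore] -/
theorem finite_setOf_absNorm_asIdeal_le (n : ℕ) :
    {v : IsDedekindDomain.HeightOneSpectrum (𝓞 K) | Ideal.absNorm v.asIdeal ≤ n}.Finite :=
  (Ideal.finite_setOf_absNorm_le n).preimage fun _ _ _ _ h ↦
    IsDedekindDomain.HeightOneSpectrum.ext h

end NumberField

/-! ### The trivial coefficient bound for `L(E, s)` -/

namespace WeierstrassCurve

open ArithmeticFunction IsDedekindDomain NumberField

variable {K : Type*} [Field K] [NumberField K] (W : WeierstrassCurve K)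

/-- Mathlib's `W.LFunction` is the Euler product over the nonzero primes `v` of `𝓞 K` of the local
Euler factors of `W` over the completions `K_v ⊇ 𝒪_v` (`rfl`; recorded to fix the shape of the
factors used below). [folklore] -/
theorem LFunction_eq_eulerProduct : W.LFunction = eulerProduct fun v : HeightOneSpectrum (𝓞 K) ↦
    (W.baseChange (v.adicCompletion K)).localEulerFactor (v.adicCompletionIntegers K) := rfl

/-- Only the finitely many primes `v` with `N(v) ≤ n` have a local Euler factor whose `n`-th
coefficient differs from that of `1`. [folklore] -/
theorem eventually_cofinite_localEulerFactor_apply (n : ℕ) :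
    ∀ᶠ v : HeightOneSpectrum (𝓞 K) in cofinite,
      (W.baseChange (v.adicCompletion K)).localEulerFactor (v.adicCompletionIntegers K) n =
        (1 : ArithmeticFunction ℤ) n := by
  rw [Filter.eventually_cofinite]
  refine (finite_setOf_absNorm_asIdeal_le K n).subset fun v hv ↦ ?_
  simp only [Set.mem_setOf_eq] at hv ⊢
  set q : ℕ := Nat.card (IsLocalRing.ResidueField (v.adicCompletionIntegers K)) with hq
  by_cases hq1 : q ≤ 1
  · exact (hv (by rw [localEulerFactor_eq_one_of_card_le_one _ _ hq1])).elim
  rw [not_le] at hq1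
  haveI : Finite (IsLocalRing.ResidueField (v.adicCompletionIntegers K)) :=
    Nat.finite_of_card_ne_zero (Nat.ne_zero_of_lt hq1)
  refine (v.absNorm_le_natCard_residueField (K := K)).trans ?_
  rw [← hq]
  by_contra hqn
  rw [not_le] at hqn
  apply hv
  rcases n with _ | _ | n
  · simp
  · rw [localEulerFactor_apply_one, one_one]
  · rw [one_apply_ne (by omega), localEulerFactor_apply_eq_zero _ _ hq1]
    rw [← hq]
    rintro ⟨k, hk⟩
    rcases k with _ | k
    · simp at hk
    · have : q ≤ q ^ (k + 1) := Nat.le_self_pow (Nat.succ_ne_zero k) q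
      omega

/-- The first Dirichlet coefficient of `L(W, s)` is `a₁ = 1` (Silverman AEC C.16). [folklore] -/
theorem LFunction_apply_one : W.LFunction 1 = 1 := by
  rw [LFunction_eq_eulerProduct]
  exact eulerProduct_apply_one W.eventually_cofinite_localEulerFactor_apply
    fun v ↦ localEulerFactor_apply_one _ _

/-- **Trivial polynomial bound on the coefficients of `L(W, s)`**: `|aₙ| ≤ C · n⁵` for all
`n ≥ 1`, with `C = exp (2 ∑_𝔭 N(𝔭)^{-2})`. (The truth is `|aₙ| ≤ d(n) √n` by Hasse's theorem;
the trivial bound uses only `|W̃(κ_𝔭)| ≤ |κ_𝔭|² + 1`.) [folklore] -/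
theorem exists_norm_LFunction_le :
    ∃ C : ℝ, ∀ n : ℕ, n ≠ 0 → ‖(W.LFunction n : ℤ)‖ ≤ C * (n : ℝ) ^ 5 := by
  have hεs : Summable fun v : HeightOneSpectrum (𝓞 K) ↦
      2 * (1 / (Ideal.absNorm v.asIdeal : ℝ) ^ 2) :=
    (summable_one_div_absNorm_sq_heightOneSpectrum K).mul_left 2
  refine ⟨Real.exp (∑' v : HeightOneSpectrum (𝓞 K), 2 * (1 / (Ideal.absNorm v.asIdeal : ℝ) ^ 2)),
    fun n hn ↦ ?_⟩
  rw [LFunction_eq_eulerProduct]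
  refine norm_eulerProduct_apply_le_exp_mul_pow W.eventually_cofinite_localEulerFactor_apply
    (ε := fun v ↦ 2 * (1 / (Ideal.absNorm v.asIdeal : ℝ) ^ 2))
    (fun v ↦ ?_) (fun v N ↦ ?_) (fun s ↦ ?_) hn
  · rw [localEulerFactor_apply_one, norm_one]
  · rcases le_or_gt (Nat.card (IsLocalRing.ResidueField (v.adicCompletionIntegers K))) 1 with
      hq1 | hq1
    · rw [localEulerFactor_eq_one_of_card_le_one _ _ hq1, sum_eq_zero fun m hm ↦ ?_]
      · positivity
      · rw [one_apply_ne (by have := (mem_Icc.mp hm).1; omega), norm_zero, zero_div]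
    · haveI : Finite (IsLocalRing.ResidueField (v.adicCompletionIntegers K)) :=
        Nat.finite_of_card_ne_zero (Nat.ne_zero_of_lt hq1)
      refine (sum_Icc_norm_localEulerFactor_div_pow_le _ _ hq1 N).trans ?_
      have hN0 : (0 : ℝ) < Ideal.absNorm v.asIdeal := by
        have := NumberField.HeightOneSpectrum.one_lt_absNorm v
        exact_mod_cast zero_lt_one.trans this
      have hNq : (Ideal.absNorm v.asIdeal : ℝ) ≤
          Nat.card (IsLocalRing.ResidueField (v.adicCompletionIntegers K)) := by
        exact_mod_cast v.absNorm_le_natCard_residueField (K := K)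
      rw [mul_one_div]
      gcongr
  · exact hεs.sum_le_tsum s fun v _ ↦ by positivity

/-- The `L`-series of `W` converges absolutely for `Re s > 6` (trivial bound; the truth is
`Re s > 3/2`, Silverman AEC C.16). [folklore] -/
theorem LSeriesSummable_LFunction_of_lt_re {s : ℂ} (hs : 6 < s.re) :
    LSeriesSummable (fun n ↦ (W.LFunction n : ℂ)) s := by
  obtain ⟨C, hC⟩ := W.exists_norm_LFunction_le
  refine LSeriesSummable_of_le_const_mul_rpow hs ⟨C, fun n hn ↦ ?_⟩
  rw [Complex.norm_intCast, ← Int.norm_eq_abs, show (6 : ℝ) - 1 = (5 : ℕ) by norm_num,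
    Real.rpow_natCast]
  exact hC n hn

/-- The abscissa of absolute convergence of `L(W, s)` is finite. [folklore] -/
theorem abscissaOfAbsConv_LFunction_lt_top :
    LSeries.abscissaOfAbsConv (fun n ↦ (W.LFunction n : ℂ)) < ⊤ :=
  (W.LSeriesSummable_LFunction_of_lt_re (s := 7) (by norm_num)).abscissaOfAbsConv_le.trans_lt
    (EReal.coe_lt_top _)

/-- `L(W, σ) → a₁ = 1` as `σ → +∞` along the reals. [folklore] -/
theorem tendsto_LSeries_atTop :
    Tendsto (fun x : ℝ ↦ W.LSeries x) atTop (nhds 1) := by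
  have := LSeries.tendsto_atTop W.abscissaOfAbsConv_LFunction_lt_top
  rw [W.LFunction_apply_one, Int.cast_one] at this
  exact this

end WeierstrassCurve

end

noncomputable section

/-! ### Discharge of `WeierstrassCurve.entireLFunction_not_eventuallyEq_zero` -/

namespace WeierstrassCurve

open Filter Topology

variable {K : Type*} [Field K] [NumberField K] {W : WeierstrassCurve K}

/-- **Discharge of the named fact `WeierstrassCurve.entireLFunction_not_eventuallyEq_zero`**
(Silverman AEC App. C §16, p. 450: `L_{E/K}(s)` is given by a convergent Dirichlet series with
`a₁ = 1` on a right half-plane). If the entire continuation vanished on a neighbourhood of `s = 1`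
it would vanish identically (identity theorem on the connected space `ℂ`), hence so would
`W.LSeries` on `Re s > 3/2`; but `L(W, σ) → a₁ = 1` as `σ → +∞`
(`WeierstrassCurve.tendsto_LSeries_atTop`, from the trivial coefficient bound
`WeierstrassCurve.exists_norm_LFunction_le`). The hypothesis `[W.IsElliptic]` of the fact is not
used. [cite: SilvermanAEC2009, App. C §16] -/
theorem entireLFunction_not_eventuallyEq_zero_holds :
    entireLFunction_not_eventuallyEq_zero (W := W) := by
  intro _ h hev
  -- the entire function vanishes identically
  have han : AnalyticOnNhd ℂ W.entireLFunction Set.univ :=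
    (W.differentiable_entireLFunction h).differentiableOn.analyticOnNhd isOpen_univ
  have hzero := han.eqOn_zero_of_preconnected_of_eventuallyEq_zero isPreconnected_univ
    (Set.mem_univ (1 : ℂ)) hev
  -- hence `L(W, x) = 0` for real `x > 3/2`, contradicting `L(W, x) → 1`
  have hev0 : (fun x : ℝ ↦ W.LSeries x) =ᶠ[atTop] fun _ ↦ 0 := by
    filter_upwards [eventually_gt_atTop (3 / 2 : ℝ)] with x hx
    rw [← W.entireLFunction_eq_LSeries h (by simpa using hx)]
    exact hzero (Set.mem_univ _)
  have h1 : (1 : ℂ) = 0 :=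
    tendsto_nhds_unique W.tendsto_LSeries_atTop (tendsto_const_nhds.congr' hev0.symm)
  exact one_ne_zero h1

end WeierstrassCurve

end
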